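import Literature.NumberTheory.LFunctions.DirichletLOneHalfLogBoundEven
import Literature.NumberTheory.LFunctions.PrimitiveQuadraticCharacterGaussSum
import Literature.NumberTheory.LFunctions.SiegelTheorem
import HarnessLib

/-!
# Louboutin's real-zero bound `L(β, χ) = 0 ⇒ 0 < L(1, χ) ≤ (1 − β) log² f / 8` for even quadratic primitive characters (proved)

Topic `Literature/NumberTheory/LFunctions`, namespace `Literature.NumberTheory.LFunctions.Louboutin2001`
(the grouping sub-namespace of the sibling file `DirichletLOneHalfLogBoundEven`, whose theta majorant
`T = thetaMajor` and fold this file reuses). Everything here is PROVED from Mathlib and the tree (no named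
facts; the only new notions are the real integral `logMajorant` = Louboutin's `Ĩ₀(f)` and the kernel
`xiKernel`). Typed by the literature-typing seat `littype-FP2-1` (cell `parity-realchar`, D-0088 (4) row (7),
conditionals column): it is the sharp-constant form of the «exceptional zero ⇒ small `L(1, χ)`» input of the
real-character ladder, which the tree so far had only in Davenport's elementary shape
(`ExceptionalZeroLOneBound.re_LFunction_one_le_of_zero`: `L(1, χ) ≤ (1 − β) Σ_{n≤N} r(n)/n + 10q/⌊√N⌋`).

## Source, as printed (read first-hand: text PDF `paper:doi-10-4064-aa121-3-1`, pp. 200–206)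

S. Louboutin, *Lower bounds for relative class numbers of imaginary abelian number fields and CM-fields*,
Acta Arith. 121 (2006) 199–220 [Louboutin2006RelativeClassNumbers].

* **Theorem 1** (p. 200): «Let `χ` be a primitive Dirichlet character modulo `f > 1`. (i) We have
  **(2)** `|L(1, χ)| ≤ ½ (log f + κ_χ)` where `κ_χ := κ₀ = 2 + γ − log(4π)` if `χ` is even, `κ₁ = 2 + γ − log π`
  if `χ` is odd. (ii) Assume that `χ` is quadratic. Then `0 < β < 1` and `L(β, χ) = 0` imply
  **(3)** `0 < L(1, χ) ≤ (1 − β)/8 · log² f`.» and Remark 2 (ii): «See [Lou98b, Corollaire 7B] for another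
  proof of (3) in the case that `χ` is even and quadratic, [Lou01, Theorem 7] for the case of `χ` even but
  not necessarily quadratic» ([Lou01] = [Louboutin2001CJM], Theorem 7 (16) p. 1197: «`½ ≤ β < 1` and
  `L(β, χ) = 0` imply `|L(1, χ)| ≤ (1 − β)/8 · log² f_χ`»).
* **Lemma 3** (p. 201), `A = 0` for even `χ`, `θ(t, χ) = Σ_{n≥1} n^A χ(n) e^{−πn²t/f}`,
  `Λ(s, χ) = (f/π)^{(s+A)/2} Γ((s+A)/2) L(s, χ)`: «`θ(1/t, χ) = W(χ) t^A √t θ(t, χ̄)`, and for `ℜ(s) > 1` we have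
  **(4)** `Λ(s, χ) = ∫₁^∞ {θ(t, χ) t^{(s+A)/2} + W(χ) θ(t, χ̄) t^{(1−s+A)/2}} dt/t`. This integral converges
  absolutely for all complex `s` … and **(5)** `W(χ) Λ(1 − s, χ̄) = Λ(s, χ)`.»
* **Proposition 5 (ii)** (p. 202) and its proof (p. 203): «if `χ` is quadratic, then `0 < β < 1` and
  `L(β, χ) = 0` imply `|Λ(1, χ)| ≤ (1 − β)/2 · Ĩ_A(f)`. … `L(β, χ) = 0` implies `Λ(β, χ) = 0` and
  `|Λ(1, χ)| = |Λ(1, χ) − Λ(β, χ)| ≤ (1 − β) max_{β≤s≤1} |Λ′(s, χ)|. … if `χ` is quadratic then `χ̄ = χ` and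
  `W(χ) = +1`. Third, due to the functional equation (5), we may assume that `1/2 ≤ β ≤ 1`. Fourth, for
  `t ≥ 1` real the function `s ↦ t^{(s+A)/2−1} − t^{(1−s+A)/2−1}` increases with `s`, and is nonnegative in
  the range `s ≥ 1/2`. Therefore, for `1/2 ≤ s ≤ 1` we have
  **(11)** `2|Λ′(s, χ)| ≤ ∫₁^∞ Σ_{n≥1} n^A e^{−πn²t/f} (log t)(t^{(1+A)/2} − t^{A/2}) dt/t`.»
* **Lemma 6** (p. 203): «If `χ` is even, then `√f |L(1, χ)| = |Λ(1, χ)|` … If `χ` is even and `L(β, χ) = 0`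
  for some `β ∈ (0, 1)`, then `√f |L(1, χ)| ≤ (1 − β)/2 · Ĩ₀(f)`.»
* **Lemma 9 (16)** (p. 206): «`Ĩ₀(f) = ¼√f((log f − κ₀′)² + κ₀″) + ¼((log f + κ₀′)² + κ₀″) + θ √(16π/9f) K̃₀
  ≤ ¼ √f log² f` for `f ≥ 5`.»

## What is proved, and how (the printed proof, §2.1, with one substitution)

In the tree's language (`DirichletLThetaRepresentation` / `DirichletThetaTransformation`:
`ϑ₀(t, χ) = dirichletTheta 0 χ t = Σ_{n∈ℤ} χ(n) e^{−πn²t/q} = 2 θ(t, χ)` for even `χ`,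
`ξ(s, χ) = dirichletXi χ s = q^{s/2} Λ_Mathlib(s, χ) = (q/π)^{s/2} Γ(s/2) L(s, χ) = Λ(s, χ)` for even `χ ≠ 1`,
root number `rootNumber χ`, transformation formula `dirichletTheta_transformation`, Mellin form
`dirichletXi_eq_mellin`, functional equation `dirichletXi_eq_rootNumber_mul_dirichletXi_inv_one_sub`):
1. `integral_rpow_mul_split` + `two_mul_dirichletXi_eq_integral_xiKernel` — Lemma 3 (4) for an even
   quadratic primitive `χ` and real `σ`: `2ξ(σ, χ) = ∫₁^∞ (t^{σ/2−1} + t^{(1−σ)/2−1}) ϑ₀(t, χ) dt`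
   (`W(χ) = 1` is the tree's `PrimitiveQuadratic.rootNumber_eq_one_of_isQuadratic`, `χ̄ = χ` is
   `MulChar.IsQuadratic.inv`).
2. `xiKernel_one_sub_le` — the monotonicity step (11): for `t ≥ 1`, `½ ≤ β ≤ 1`,
   `0 ≤ φ_t(1) − φ_t(β) ≤ (1 − β) · ½ (log t)(t^{−1/2} − t^{−1})`, `φ_t(s) = t^{s/2−1} + t^{(1−s)/2−1}`
   (mean value theorem on `[½, 1]`, derivative bounded by its value at `s = 1`).
3. `norm_LFunction_one_le_of_zero_of_half_le` — Prop. 5 (ii)/Lemma 6: `ξ(β) = 0`, so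
   `2√q |L(1, χ)| = |2ξ(1) − 2ξ(β)| ≤ (1 − β) · M(q)` with `M(q) = logMajorant q = Ĩ₀(q)` written as the real
   integral of (11) (`|ϑ₀(t, χ)| ≤ 2T(t/q)`, the sibling file's `norm_dirichletTheta_zero_le`).
4. `logMajorant_le` — **the substitution**: instead of the contour shift of Lemma 9 (16) (residues with the
   Stieltjes constant `γ(1)` and the numerical integral `K̃₀`), `M(q) ≤ ¼ √q log² q` is proved for every real
   `q ≥ 2` by the elementary fold of the sibling file (`T(1/v) = √v T(v) + (√v − 1)/2`, an explicit
   antiderivative on `(1, q)`, `log v ≤ 2√v` and `∫₁^∞ T ≤ 1/57` on `(q, ∞)`), with remainder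
   `¼ log² q + log q − √q log q + √q(2 log q + 2)/57 ≤ 0`.
5. `norm_LFunction_one_le_of_zero` — all `0 < β < 1` by the functional equation (5) (`β ↦ 1 − β`), and
   `LFunction_one_re_pos_and_le_of_zero` — the printed `0 < L(1, χ) ≤ (1 − β) log² f / 8` on the real number
   `L(1, χ)` (positivity is the tree's `Siegel.LFunction_one_re_pos`).
The ODD case of Theorem 1 (ii) (constant `Ĩ₁(f)`, Lemma 9 (17)) is NOT in this file.

## References
* [Louboutin2006RelativeClassNumbers] S. Louboutin, Acta Arith. 121 (2006) 199–220, doi 10.4064/aa121-3-1.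
* [Louboutin2001CJM] S. Louboutin, Canad. J. Math. 53 (2001) 1194–1222, doi 10.4153/CJM-2001-045-5.
-/

noncomputable section

open Complex Real MeasureTheory Filter Topology Set HurwitzZeta

namespace Literature.NumberTheory.LFunctions

namespace Louboutin2001

/-! ### The majorant toolkit (re-derived: the sibling file keeps these private) -/

/-- `T = (θ − 1)/2` on `(0, ∞)`. [folklore] -/
private theorem thetaMajor_eq_evenKernel' {t : ℝ} (ht : 0 < t) :
    thetaMajor t = (evenKernel 0 t - 1) / 2 := by
  have hZ : HasSum (fun n : ℤ ↦ rexp (-(π * (n : ℝ) ^ 2 * t))) (evenKernel 0 t) := by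
    have h := hasSum_int_evenKernel 0 ht
    simp only [add_zero, QuotientAddGroup.mk_zero] at h
    refine h.congr_fun fun n ↦ ?_
    ring_nf
  have hN := hZ.nat_add_neg_add_one
  have hT := hasSum_thetaMajor ht
  have hT0 : HasSum (fun n : ℕ ↦ rexp (-(π * (n : ℝ) ^ 2 * t))) (thetaMajor t + 1) := by
    set F : ℕ → ℝ := fun n ↦ rexp (-(π * (n : ℝ) ^ 2 * t)) with hF
    have h1' : HasSum (fun n : ℕ ↦ F (n + 1)) (thetaMajor t) := by
      refine hT.congr_fun fun n ↦ ?_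
      simp only [hF]; push_cast; ring_nf
    have h2 : HasSum F (thetaMajor t + ∑ i ∈ Finset.range 1, F i) := (hasSum_nat_add_iff 1).mp h1'
    simpa [hF] using h2
  have hsum : HasSum (fun n : ℕ ↦ rexp (-(π * (n : ℝ) ^ 2 * t)) + rexp (-(π * ((n : ℝ) + 1) ^ 2 * t)))
      (thetaMajor t + 1 + thetaMajor t) := hT0.add hT
  have hN' : HasSum (fun n : ℕ ↦ rexp (-(π * (n : ℝ) ^ 2 * t)) + rexp (-(π * ((n : ℝ) + 1) ^ 2 * t)))
      (evenKernel 0 t) := by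
    refine hN.congr_fun fun n ↦ ?_
    push_cast
    ring_nf
  have := hN'.unique hsum
  rw [this]; ring

/-- `T` is continuous on `(0, ∞)`. [folklore] -/
private theorem continuousOn_thetaMajor' : ContinuousOn thetaMajor (Ioi 0) := by
  have h : ContinuousOn (fun t ↦ (evenKernel 0 t - 1) / 2) (Ioi 0) :=
    ((continuousOn_evenKernel 0).sub continuousOn_const).div_const _
  exact h.congr fun t ht ↦ thetaMajor_eq_evenKernel' ht

/-- `T(t) ≤ e^{−πt}/(1 − e^{−3πt})` for `t > 0`. [folklore] -/
private theorem thetaMajor_le_geom' {t : ℝ} (ht : 0 < t) :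
    thetaMajor t ≤ rexp (-(π * t)) / (1 - rexp (-(3 * π * t))) := by
  have hr0 : 0 ≤ rexp (-(3 * π * t)) := (Real.exp_pos _).le
  have hr1 : rexp (-(3 * π * t)) < 1 := by
    rw [Real.exp_lt_one_iff]; have := Real.pi_pos; nlinarith
  have hgeom : HasSum (fun n : ℕ ↦ rexp (-(π * t)) * rexp (-(3 * π * t)) ^ n)
      (rexp (-(π * t)) * (1 - rexp (-(3 * π * t)))⁻¹) :=
    (hasSum_geometric_of_lt_one hr0 hr1).mul_left _
  rw [div_eq_mul_inv]
  refine hasSum_le (fun n ↦ ?_) (hasSum_thetaMajor ht) hgeom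
  rw [← Real.exp_nat_mul, ← Real.exp_add, Real.exp_le_exp]
  have hn : (n : ℝ) ≤ (n : ℝ) ^ 2 := by exact_mod_cast Nat.le_self_pow two_ne_zero n
  have := mul_pos Real.pi_pos ht
  nlinarith [mul_le_mul_of_nonneg_left hn this.le]

/-- `v ↦ T(v) g(v)` is integrable on `(a, ∞)`, `a > 0`, for `g` continuous on `(0,∞)` and bounded on
`(a, ∞)`. [folklore] -/
private theorem integrableOn_thetaMajor_mul' {a B : ℝ} (ha : 0 < a) {g : ℝ → ℝ}
    (hg : ContinuousOn g (Ioi 0)) (hB : ∀ v, a < v → |g v| ≤ B) :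
    IntegrableOn (fun v ↦ thetaMajor v * g v) (Ioi a) := by
  have hmeas : AEStronglyMeasurable (fun v ↦ thetaMajor v * g v) (volume.restrict (Ioi a)) := by
    refine ContinuousOn.aestronglyMeasurable ?_ measurableSet_Ioi
    exact (continuousOn_thetaMajor'.mono (Ioi_subset_Ioi ha.le)).mul (hg.mono (Ioi_subset_Ioi ha.le))
  have hq0 : rexp (-(3 * π * a)) < 1 := by
    rw [Real.exp_lt_one_iff]; have := Real.pi_pos; nlinarith
  set C : ℝ := (1 - rexp (-(3 * π * a)))⁻¹ with hC
  have hCpos : 0 < C := inv_pos.mpr (by linarith)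
  have hdom : IntegrableOn (fun v : ℝ ↦ B * C * rexp (-π * v)) (Ioi a) :=
    ((exp_neg_integrableOn_Ioi a Real.pi_pos).const_mul _)
  refine Integrable.mono' hdom hmeas ?_
  refine (ae_restrict_iff' measurableSet_Ioi).mpr (ae_of_all _ fun v (hv : a < v) ↦ ?_)
  have hv0 : 0 < v := ha.trans hv
  have hB0 : 0 ≤ B := (abs_nonneg _).trans (hB v hv)
  rw [norm_mul, Real.norm_eq_abs, Real.norm_eq_abs, abs_of_nonneg (thetaMajor_nonneg v)]
  have h1 := thetaMajor_le_geom' hv0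
  have hA : rexp (-(3 * π * v)) ≤ rexp (-(3 * π * a)) := by
    rw [Real.exp_le_exp]; nlinarith [Real.pi_pos]
  have h2 : thetaMajor v ≤ C * rexp (-π * v) := by
    calc thetaMajor v ≤ rexp (-(π * v)) / (1 - rexp (-(3 * π * v))) := h1
      _ ≤ rexp (-(π * v)) / (1 - rexp (-(3 * π * a))) :=
          div_le_div_of_nonneg_left (Real.exp_pos _).le (by linarith) (by linarith)
      _ = C * rexp (-π * v) := by rw [hC, div_eq_inv_mul, neg_mul]
  calc thetaMajor v * |g v| ≤ (C * rexp (-π * v)) * B :=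
        mul_le_mul h2 (hB v hv) (abs_nonneg _) (by positivity)
    _ = B * C * rexp (-π * v) := by ring

/-- `∫₁^∞ T(v) dv ≤ 1/57` (`T(v) ≤ e^{−πv}/(1 − e^{−3π})`, `e^{−π} < e^{−3} < 1/20`). [folklore] -/
private theorem integral_thetaMajor_le : ∫ v in Ioi (1 : ℝ), thetaMajor v ≤ 1 / 57 := by
  have hI : IntegrableOn (fun v ↦ thetaMajor v * (1 : ℝ)) (Ioi 1) :=
    integrableOn_thetaMajor_mul' (B := 1) one_pos continuousOn_const fun v _ ↦ by simp
  simp only [mul_one] at hI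
  have he3 : rexp (-3) < 1 / 20 := by
    have h := Real.exp_one_gt_d9
    have h3 : (20 : ℝ) < rexp 3 := by
      have e3 : rexp 3 = rexp 1 ^ 3 := by rw [← Real.exp_nat_mul]; norm_num
      rw [e3]
      have : (2.7182818283 : ℝ) ^ 3 < rexp 1 ^ 3 := by gcongr
      nlinarith
    have := (inv_lt_inv₀ (Real.exp_pos 3) (by norm_num : (0:ℝ) < 20)).mpr h3
    rw [Real.exp_neg]
    linarith [show (20 : ℝ)⁻¹ = 1 / 20 by norm_num]
  have hπ3 : (3 : ℝ) < π := by linarith [Real.pi_gt_three]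
  have heπ : rexp (-π) ≤ rexp (-3) := Real.exp_le_exp.mpr (by linarith)
  have he3π : rexp (-(3 * π)) ≤ 1 / 20 := by
    have : rexp (-(3 * π)) ≤ rexp (-3) := Real.exp_le_exp.mpr (by linarith)
    linarith
  set C : ℝ := (1 - rexp (-(3 * π)))⁻¹ with hC
  have hC' : C ≤ 20 / 19 := by
    rw [hC, inv_le_comm₀ (by linarith [Real.exp_pos (-(3 * π))]) (by norm_num)]
    linarith
  have hCpos : 0 < C := by rw [hC]; exact inv_pos.mpr (by linarith)
  -- pointwise domination on `(1, ∞)`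
  have hdomI : IntegrableOn (fun v : ℝ ↦ C * rexp (-π * v)) (Ioi 1) :=
    (exp_neg_integrableOn_Ioi 1 Real.pi_pos).const_mul _
  have hle : ∫ v in Ioi (1 : ℝ), thetaMajor v ≤ ∫ v in Ioi (1 : ℝ), C * rexp (-π * v) := by
    refine setIntegral_mono_on hI hdomI measurableSet_Ioi fun v (hv : 1 < v) ↦ ?_
    have hv0 : 0 < v := by linarith
    have h1 := thetaMajor_le_geom' hv0
    have hA : rexp (-(3 * π * v)) ≤ rexp (-(3 * π)) := Real.exp_le_exp.mpr (by nlinarith)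
    calc thetaMajor v ≤ rexp (-(π * v)) / (1 - rexp (-(3 * π * v))) := h1
      _ ≤ rexp (-(π * v)) / (1 - rexp (-(3 * π))) :=
          div_le_div_of_nonneg_left (Real.exp_pos _).le (by linarith) (by linarith)
      _ = C * rexp (-π * v) := by rw [hC, div_eq_inv_mul, neg_mul]
  have hval : ∫ v in Ioi (1 : ℝ), C * rexp (-π * v) = C * (rexp (-π) / π) := by
    rw [integral_const_mul, integral_exp_mul_Ioi (by linarith) 1]
    congr 1; field_simp
  rw [hval] at hle
  have h3 : rexp (-π) / π ≤ (1 / 20) / 3 := by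
    rw [div_le_div_iff₀ Real.pi_pos (by norm_num)]
    nlinarith [Real.exp_pos (-π)]
  calc ∫ v in Ioi (1 : ℝ), thetaMajor v ≤ C * (rexp (-π) / π) := hle
    _ ≤ (20 / 19) * ((1 / 20) / 3) := mul_le_mul hC' h3 (by positivity) (by norm_num)
    _ = 1 / 57 := by norm_num

/-- Jacobi's transformation in square-root form: `T(1/w) = √w T(w) + (√w − 1)/2`. [folklore] -/
private theorem thetaMajor_inv_sqrt {w : ℝ} (hw : 0 < w) :
    thetaMajor (1 / w) = Real.sqrt w * thetaMajor w + (Real.sqrt w - 1) / 2 := by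
  rw [thetaMajor_inv hw, Real.sqrt_eq_rpow]

/-! ### The log-weighted fold (Louboutin 2006 (16): `Ĩ₀(f) ≤ ¼√f log² f`) -/

/-- The log-weighted majorant `M(q) = ∫₁^∞ T(t/q) (log t) (t^{−1/2} − t^{−1}) dt`
(Louboutin's `Ĩ₀(f)` of (8)/(11), in the variable `t`). [cite: Louboutin2006RelativeClassNumbers, (11) p. 203] -/
def logMajorant (q : ℝ) : ℝ :=
  ∫ t in Ioi (1 : ℝ), thetaMajor (t / q) * (Real.log t * ((Real.sqrt t)⁻¹ - t⁻¹))

/-- The antiderivative used for the elementary part of the folded integral. [folklore] -/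
private def antiF (d L w : ℝ) : ℝ :=
  (d * (L * Real.log w - Real.log w ^ 2 / 2)
    - (2 * L * Real.sqrt w - 2 * Real.sqrt w * Real.log w + 4 * Real.sqrt w)
    - d * (-2 * L / Real.sqrt w + 2 * Real.log w / Real.sqrt w + 4 / Real.sqrt w)
    + (L * Real.log w - Real.log w ^ 2 / 2)) / 2

/-- `F' = h` on `(0, ∞)` with `h(w) = ½ (L − log w)(d w^{−1} − w^{−1/2} − d w^{−3/2} + w^{−1})`. [folklore] -/
private theorem hasDerivAt_antiF (d L : ℝ) {w : ℝ} (hw : 0 < w) :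
    HasDerivAt (antiF d L) ((L - Real.log w) *
      (d * w⁻¹ - (Real.sqrt w)⁻¹ - d * ((Real.sqrt w)⁻¹ * w⁻¹) + w⁻¹) / 2) w := by
  have hs : 0 < Real.sqrt w := Real.sqrt_pos.mpr hw
  have hlog : HasDerivAt Real.log w⁻¹ w := Real.hasDerivAt_log hw.ne'
  have hsq : HasDerivAt Real.sqrt (1 / (2 * Real.sqrt w)) w := Real.hasDerivAt_sqrt hw.ne'
  unfold antiF
  have h1 : HasDerivAt (fun w ↦ L * Real.log w - Real.log w ^ 2 / 2)
      (L * w⁻¹ - 2 * Real.log w * w⁻¹ / 2) w :=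
    (hlog.const_mul L).sub ((hlog.pow 2).div_const 2) |>.congr_deriv (by simp)
  have h2 : HasDerivAt (fun w ↦ 2 * L * Real.sqrt w - 2 * Real.sqrt w * Real.log w + 4 * Real.sqrt w)
      (2 * L * (1 / (2 * Real.sqrt w)) - (2 * (1 / (2 * Real.sqrt w)) * Real.log w
        + 2 * Real.sqrt w * w⁻¹) + 4 * (1 / (2 * Real.sqrt w))) w := by
    refine ((hsq.const_mul (2 * L)).sub ?_).add (hsq.const_mul 4)
    have := (hsq.const_mul 2).mul hlog
    exact this.congr_deriv (by ring)
  have h3 : HasDerivAt (fun w ↦ -2 * L / Real.sqrt w + 2 * Real.log w / Real.sqrt w + 4 / Real.sqrt w)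
      ((0 * Real.sqrt w - (-2 * L) * (1 / (2 * Real.sqrt w))) / Real.sqrt w ^ 2
        + ((2 * w⁻¹) * Real.sqrt w - (2 * Real.log w) * (1 / (2 * Real.sqrt w))) / Real.sqrt w ^ 2
        + (0 * Real.sqrt w - 4 * (1 / (2 * Real.sqrt w))) / Real.sqrt w ^ 2) w :=
    (((hasDerivAt_const w (-2 * L)).div hsq hs.ne').add ((hlog.const_mul 2).div hsq hs.ne')).add
      ((hasDerivAt_const w 4).div hsq hs.ne')
  have hsum := ((((h1.const_mul d).sub h2).sub (h3.const_mul d)).add h1).div_const 2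
  refine hsum.congr_deriv ?_
  have hsw2 : Real.sqrt w ^ 2 = w := Real.sq_sqrt hw.le
  have hsw3 : Real.sqrt w ^ 3 = w * Real.sqrt w := by rw [pow_succ, hsw2]
  field_simp
  simp only [hsw2, hsw3]
  ring


/-- The scaled weight: `q · log(qv) · ((qv)^{−1/2} − (qv)^{−1}) = (log q + log v)(√q (√v)⁻¹ − v⁻¹)`. [folklore] -/
private theorem scaled_logWeight {q v : ℝ} (hq : 0 < q) (hv : 0 < v) :
    q * (Real.log (q * v) * ((Real.sqrt (q * v))⁻¹ - (q * v)⁻¹)) =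
      (Real.log q + Real.log v) * (Real.sqrt q * (Real.sqrt v)⁻¹ - v⁻¹) := by
  rw [Real.log_mul hq.ne' hv.ne', Real.sqrt_mul hq.le, mul_inv, mul_inv]
  have hsq : Real.sqrt q * Real.sqrt q = q := Real.mul_self_sqrt hq.le
  have hs0 : Real.sqrt q ≠ 0 := (Real.sqrt_pos.mpr hq).ne'
  have h1 : q * (Real.sqrt q)⁻¹ = Real.sqrt q := by
    rw [mul_inv_eq_iff_eq_mul₀ hs0]; exact hsq.symm
  have h2 : q * q⁻¹ = 1 := mul_inv_cancel₀ hq.ne'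
  calc q * ((Real.log q + Real.log v) * ((Real.sqrt q)⁻¹ * (Real.sqrt v)⁻¹ - q⁻¹ * v⁻¹))
      = (Real.log q + Real.log v) * ((q * (Real.sqrt q)⁻¹) * (Real.sqrt v)⁻¹ - (q * q⁻¹) * v⁻¹) := by ring
    _ = _ := by rw [h1, h2, one_mul]

/-- `log v ≤ 2 √v` for `v ≥ 0`. [folklore] -/
private theorem log_le_two_sqrt {v : ℝ} (hv : 0 ≤ v) : Real.log v ≤ 2 * Real.sqrt v := by
  have h := Real.log_le_rpow_div hv (by norm_num : (0:ℝ) < 1 / 2)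
  rw [← Real.sqrt_eq_rpow] at h
  linarith

/-- **The log-weighted fold** (Louboutin 2006 (16) in the variable `t = x`… of the tree's theta split):
for `q ≥ 2`, `M(q) = ∫₁^∞ T(t/q)(log t)(t^{−1/2} − t^{−1}) dt ≤ ¼ √q log² q + (¼ log² q + log q − √q log q)
+ √q (2 log q + 2) ∫₁^∞ T`. [cite: Louboutin2006RelativeClassNumbers, Lemma 9 (16) p. 206] -/
theorem logMajorant_le_aux {q : ℝ} (hq : 1 ≤ q) :
    logMajorant q ≤ Real.sqrt q * Real.log q ^ 2 / 4 +
      (Real.log q ^ 2 / 4 + Real.log q - Real.sqrt q * Real.log q) +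
      Real.sqrt q * (2 * Real.log q + 2) * ∫ v in Ioi (1 : ℝ), thetaMajor v := by
  have hq0 : 0 < q := by linarith
  have hqi : 0 < q⁻¹ := inv_pos.mpr hq0
  set d : ℝ := Real.sqrt q with hd
  set L : ℝ := Real.log q with hL
  have hd1 : 1 ≤ d := by rw [hd]; exact Real.one_le_sqrt.mpr hq
  have hd0 : 0 < d := by linarith
  have hL0 : 0 ≤ L := Real.log_nonneg hq
  have hdd : d * d = q := Real.mul_self_sqrt hq0.le
  set C : ℝ := ∫ v in Ioi (1 : ℝ), thetaMajor v with hC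
  have hC0 : 0 ≤ C := setIntegral_nonneg measurableSet_Ioi fun v _ ↦ thetaMajor_nonneg v
  -- the scaled weight
  set G : ℝ → ℝ := fun v ↦ (L + Real.log v) * (d * (Real.sqrt v)⁻¹ - v⁻¹) with hG
  have hGcont : ContinuousOn G (Ioi 0) := by
    refine ContinuousOn.mul (continuousOn_const.add (Real.continuousOn_log.mono fun x (hx : 0 < x) ↦ hx.ne')) ?_
    refine ContinuousOn.sub (continuousOn_const.mul ((Real.continuous_sqrt.continuousOn).inv₀
      fun x (hx : 0 < x) ↦ (Real.sqrt_pos.mpr hx).ne')) (continuousOn_inv₀.mono fun x (hx : 0 < x) ↦ hx.ne')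
  -- bound for `G` on `(1/q, ∞)`
  have hGbd : ∀ v, q⁻¹ < v → |G v| ≤ L * (d + 1) + 2 * d + 2 + 4 * L * q := by
    intro v hv
    have hv0 : 0 < v := hqi.trans hv
    have hsv : 0 < Real.sqrt v := Real.sqrt_pos.mpr hv0
    have hsvi : (Real.sqrt v)⁻¹ < d := by
      have h1 : Real.sqrt q⁻¹ < Real.sqrt v := Real.sqrt_lt_sqrt hqi.le hv
      rw [Real.sqrt_inv] at h1
      calc (Real.sqrt v)⁻¹ < (Real.sqrt q)⁻¹⁻¹ := by
            exact inv_strictAnti₀ (inv_pos.mpr (Real.sqrt_pos.mpr hq0)) h1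
        _ = d := by rw [inv_inv]
    have hvi : v⁻¹ < q := by
      calc v⁻¹ < q⁻¹⁻¹ := inv_strictAnti₀ hqi hv
        _ = q := inv_inv q
    simp only [hG]
    rw [abs_mul]
    rcases le_or_gt 1 v with h1 | h1
    · -- `v ≥ 1`
      have hlogv : 0 ≤ Real.log v := Real.log_nonneg h1
      have hlog2 : Real.log v ≤ 2 * Real.sqrt v := log_le_two_sqrt hv0.le
      have hsv1 : 1 ≤ Real.sqrt v := Real.one_le_sqrt.mpr h1
      have hA : |L + Real.log v| = L + Real.log v := abs_of_nonneg (by linarith)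
      have hB : |d * (Real.sqrt v)⁻¹ - v⁻¹| ≤ d * (Real.sqrt v)⁻¹ + v⁻¹ := by
        refine (abs_sub _ _).trans (le_of_eq ?_)
        rw [abs_of_nonneg (by positivity), abs_of_nonneg (by positivity)]
      rw [hA]
      have hsi1 : (Real.sqrt v)⁻¹ ≤ 1 := inv_le_one_of_one_le₀ hsv1
      have hvi1 : v⁻¹ ≤ 1 := inv_le_one_of_one_le₀ h1
      calc (L + Real.log v) * |d * (Real.sqrt v)⁻¹ - v⁻¹|
          ≤ (L + Real.log v) * (d * (Real.sqrt v)⁻¹ + v⁻¹) :=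
            mul_le_mul_of_nonneg_left hB (by linarith)
        _ = L * (d * (Real.sqrt v)⁻¹ + v⁻¹) + Real.log v * (Real.sqrt v)⁻¹ * d
            + Real.log v * v⁻¹ := by ring
        _ ≤ L * (d * 1 + 1) + 2 * d + 2 := by
            have e1 : Real.log v * (Real.sqrt v)⁻¹ ≤ 2 := by
              rw [mul_inv_le_iff₀ hsv]; linarith
            have e2 : Real.log v * v⁻¹ ≤ 2 := by
              rw [mul_inv_le_iff₀ hv0]
              have : Real.sqrt v ≤ v := by
                calc Real.sqrt v = Real.sqrt v * 1 := (mul_one _).symm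
                  _ ≤ Real.sqrt v * Real.sqrt v := mul_le_mul_of_nonneg_left hsv1 hsv.le
                  _ = v := Real.mul_self_sqrt hv0.le
              linarith
            have e3 : L * (d * (Real.sqrt v)⁻¹ + v⁻¹) ≤ L * (d * 1 + 1) := by
              apply mul_le_mul_of_nonneg_left _ hL0
              nlinarith
            nlinarith
        _ ≤ L * (d + 1) + 2 * d + 2 + 4 * L * q := by nlinarith
    · -- `1/q < v < 1`
      have hlogv : Real.log v < 0 := Real.log_neg hv0 h1
      have hlogq : -L < Real.log v := by
        have := Real.log_lt_log hqi hv
        rwa [Real.log_inv] at this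
      have hA : |L + Real.log v| ≤ L := by
        rw [abs_le]; constructor <;> linarith
      have hB : |d * (Real.sqrt v)⁻¹ - v⁻¹| ≤ d * d + q := by
        refine (abs_sub _ _).trans ?_
        rw [abs_of_nonneg (by positivity), abs_of_nonneg (by positivity)]
        nlinarith
      calc |L + Real.log v| * |d * (Real.sqrt v)⁻¹ - v⁻¹| ≤ L * (d * d + q) :=
            mul_le_mul hA hB (abs_nonneg _) hL0
        _ = 2 * L * q := by rw [hdd]; ring
        _ ≤ L * (d + 1) + 2 * d + 2 + 4 * L * q := by nlinarith
  have hTG : IntegrableOn (fun v ↦ thetaMajor v * G v) (Ioi q⁻¹) :=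
    integrableOn_thetaMajor_mul' hqi hGcont hGbd
  -- Step 1: scaling `t = q v`
  have step1 : logMajorant q = ∫ v in Ioi q⁻¹, thetaMajor v * G v := by
    rw [logMajorant]
    have h := integral_comp_mul_left_Ioi
      (fun v ↦ thetaMajor v * (q * (Real.log (q * v) * ((Real.sqrt (q * v))⁻¹ - (q * v)⁻¹)))) 1 hqi
    rw [mul_one] at h
    have lhs : (fun t ↦ thetaMajor (t / q) * (Real.log t * ((Real.sqrt t)⁻¹ - t⁻¹))) =
        fun t ↦ q⁻¹ * (thetaMajor (q⁻¹ * t) *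
          (q * (Real.log (q * (q⁻¹ * t)) * ((Real.sqrt (q * (q⁻¹ * t)))⁻¹ - (q * (q⁻¹ * t))⁻¹)))) := by
      funext t
      have ht' : q * (q⁻¹ * t) = t := by field_simp
      simp only [ht']
      rw [div_eq_inv_mul]
      field_simp
    rw [lhs, integral_const_mul, h, smul_eq_mul, inv_inv, ← mul_assoc, inv_mul_cancel₀ hq0.ne', one_mul]
    refine setIntegral_congr_fun measurableSet_Ioi fun v (hv : q⁻¹ < v) ↦ ?_
    simp only [hG, hd, hL]
    rw [scaled_logWeight hq0 (hqi.trans hv)]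
  -- Step 2: split at `v = 1`
  have hsplit : Ioi q⁻¹ = Ioc q⁻¹ 1 ∪ Ioi 1 := (Ioc_union_Ioi_eq_Ioi (inv_le_one_of_one_le₀ hq)).symm
  have step2 : ∫ v in Ioi q⁻¹, thetaMajor v * G v =
      (∫ v in Ioc q⁻¹ 1, thetaMajor v * G v) + ∫ v in Ioi 1, thetaMajor v * G v := by
    rw [hsplit]
    exact setIntegral_union (Set.disjoint_left.mpr fun x hx hx' ↦ (not_lt.mpr hx.2) hx')
      measurableSet_Ioi (hTG.mono_set (by rw [hsplit]; exact subset_union_left))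
      (hTG.mono_set (by rw [hsplit]; exact subset_union_right))
  -- Step 3: the tail
  have hIT : IntegrableOn (fun v ↦ thetaMajor v) (Ioi 1) := by
    have := integrableOn_thetaMajor_mul' (B := 1) one_pos continuousOn_const (g := fun _ ↦ (1:ℝ))
      fun v _ ↦ by simp
    simpa using this
  have step3 : ∫ v in Ioi 1, thetaMajor v * G v ≤ d * (L + 2) * C := by
    have hle : ∫ v in Ioi 1, thetaMajor v * G v ≤ ∫ v in Ioi 1, thetaMajor v * (d * (L + 2)) := by
      refine setIntegral_mono_on (hTG.mono_set (Ioi_subset_Ioi (inv_le_one_of_one_le₀ hq)))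
        (hIT.mul_const _) measurableSet_Ioi fun v (hv : 1 < v) ↦ ?_
      have hv0 : 0 < v := by linarith
      have hsv : 0 < Real.sqrt v := Real.sqrt_pos.mpr hv0
      have hsv1 : 1 ≤ Real.sqrt v := Real.one_le_sqrt.mpr hv.le
      have hlogv : 0 ≤ Real.log v := Real.log_nonneg hv.le
      refine mul_le_mul_of_nonneg_left ?_ (thetaMajor_nonneg v)
      simp only [hG]
      have hsi1 : (Real.sqrt v)⁻¹ ≤ 1 := inv_le_one_of_one_le₀ hsv1
      have e1 : Real.log v * (Real.sqrt v)⁻¹ ≤ 2 := by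
        rw [mul_inv_le_iff₀ hsv]; linarith [log_le_two_sqrt hv0.le]
      calc (L + Real.log v) * (d * (Real.sqrt v)⁻¹ - v⁻¹)
          ≤ (L + Real.log v) * (d * (Real.sqrt v)⁻¹) := by
            apply mul_le_mul_of_nonneg_left _ (by linarith)
            linarith [inv_pos.mpr hv0]
        _ = d * (L * (Real.sqrt v)⁻¹ + Real.log v * (Real.sqrt v)⁻¹) := by ring
        _ ≤ d * (L * 1 + 2) := by
            apply mul_le_mul_of_nonneg_left _ hd0.le
            nlinarith
        _ = d * (L + 2) := by ring
    rw [integral_mul_const] at hle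
    calc ∫ v in Ioi 1, thetaMajor v * G v ≤ (∫ v in Ioi 1, thetaMajor v) * (d * (L + 2)) := hle
      _ = d * (L + 2) * C := by rw [hC]; ring
  -- Step 4: the bulk, folded onto `(1, q)` by `v = 1/w`
  have h0 : (0 : ℝ) ∉ Set.uIcc (1 : ℝ) q := by
    rw [Set.uIcc_of_le hq]; intro h; exact absurd h.1 (by norm_num)
  have step4 : ∫ v in Ioc q⁻¹ 1, thetaMajor v * G v =
      ∫ w in (1 : ℝ)..q, thetaMajor w⁻¹ * G w⁻¹ * (w ^ 2)⁻¹ := by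
    rw [← intervalIntegral.integral_of_le (inv_le_one_of_one_le₀ hq)]
    have hderiv : ∀ x ∈ Set.uIcc (1 : ℝ) q, HasDerivAt (fun w : ℝ ↦ w⁻¹) (-(x ^ 2)⁻¹) x := by
      intro x hx
      rw [Set.uIcc_of_le hq] at hx
      exact hasDerivAt_inv (by linarith [hx.1])
    have hcont : ContinuousOn (fun x : ℝ ↦ -(x ^ 2)⁻¹) (Set.uIcc (1 : ℝ) q) := by
      refine ContinuousOn.neg (ContinuousOn.inv₀ (continuousOn_pow 2) fun x hx ↦ ?_)
      rw [Set.uIcc_of_le hq] at hx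
      exact pow_ne_zero 2 (by linarith [hx.1])
    have himg : (fun w : ℝ ↦ w⁻¹) '' Set.uIcc (1 : ℝ) q ⊆ Ioi 0 := by
      rintro _ ⟨x, hx, rfl⟩
      rw [Set.uIcc_of_le hq] at hx
      have hx0 : (0 : ℝ) < x := by linarith [hx.1]
      simpa only [mem_Ioi] using inv_pos.mpr hx0
    have hg : ContinuousOn (fun v ↦ thetaMajor v * G v) ((fun w : ℝ ↦ w⁻¹) '' Set.uIcc (1 : ℝ) q) :=
      ((continuousOn_thetaMajor'.mul hGcont).mono himg)
    have hsub := intervalIntegral.integral_comp_mul_deriv' hderiv hcont hg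
    rw [inv_one] at hsub
    rw [intervalIntegral.integral_symm, ← hsub, ← intervalIntegral.integral_neg]
    refine intervalIntegral.integral_congr fun w _ ↦ ?_
    simp only [Function.comp_apply]
    ring
  -- the folded integrand
  set hfun : ℝ → ℝ := fun w ↦ (L - Real.log w) *
      (d * w⁻¹ - (Real.sqrt w)⁻¹ - d * ((Real.sqrt w)⁻¹ * w⁻¹) + w⁻¹) / 2 with hhfun
  set Tpart : ℝ → ℝ := fun w ↦ thetaMajor w * ((L - Real.log w) * (d * w⁻¹ - (Real.sqrt w)⁻¹)) with hTpart
  have hfold_pt : ∀ w ∈ Set.uIcc (1 : ℝ) q,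
      thetaMajor w⁻¹ * G w⁻¹ * (w ^ 2)⁻¹ = Tpart w + hfun w := by
    intro w hw
    rw [Set.uIcc_of_le hq] at hw
    have hw0 : 0 < w := by linarith [hw.1]
    have hsw : 0 < Real.sqrt w := Real.sqrt_pos.mpr hw0
    have hsw2 : Real.sqrt w * Real.sqrt w = w := Real.mul_self_sqrt hw0.le
    simp only [hTpart, hhfun, hG]
    rw [show w⁻¹ = 1 / w from (one_div w).symm, thetaMajor_inv_sqrt hw0, Real.log_div one_ne_zero hw0.ne',
      Real.log_one, zero_sub, Real.sqrt_div' 1 hw0.le, Real.sqrt_one]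
    field_simp
    linear_combination (L - Real.log w) *
      (2 * Real.sqrt w * thetaMajor w * d - 2 * thetaMajor w * w + Real.sqrt w * d - w - d) * hsw2
  have hsubI : Set.uIcc (1 : ℝ) q ⊆ Ioi 0 := by
    intro x hx; rw [Set.uIcc_of_le hq] at hx; exact (show (0:ℝ) < x by linarith [hx.1])
  have hi : ContinuousOn (fun x : ℝ ↦ x⁻¹) (Ioi 0) := continuousOn_inv₀.mono fun x (hx : 0 < x) ↦ hx.ne'
  have hs : ContinuousOn (fun x : ℝ ↦ (Real.sqrt x)⁻¹) (Ioi 0) :=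
    (Real.continuous_sqrt.continuousOn).inv₀ fun x (hx : 0 < x) ↦ (Real.sqrt_pos.mpr hx).ne'
  have hlg : ContinuousOn (fun x : ℝ ↦ L - Real.log x) (Ioi 0) :=
    continuousOn_const.sub (Real.continuousOn_log.mono fun x (hx : 0 < x) ↦ hx.ne')
  have hc1 : ContinuousOn Tpart (Set.uIcc (1 : ℝ) q) :=
    (continuousOn_thetaMajor'.mul (hlg.mul ((continuousOn_const.mul hi).sub hs))).mono hsubI
  have hc2 : ContinuousOn hfun (Set.uIcc (1 : ℝ) q) :=
    ((hlg.mul ((((continuousOn_const.mul hi).sub hs).sub (continuousOn_const.mul (hs.mul hi))).add hi)).div_const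
      _).mono hsubI
  have step5 : ∫ w in (1 : ℝ)..q, thetaMajor w⁻¹ * G w⁻¹ * (w ^ 2)⁻¹ =
      (∫ w in (1 : ℝ)..q, Tpart w) + ∫ w in (1 : ℝ)..q, hfun w := by
    rw [intervalIntegral.integral_congr hfold_pt]
    exact intervalIntegral.integral_add hc1.intervalIntegrable hc2.intervalIntegrable
  -- Step 5: the elementary part by the fundamental theorem of calculus
  have step6 : ∫ w in (1 : ℝ)..q, hfun w = d * L ^ 2 / 4 + L ^ 2 / 4 + L - d * L := by
    have hderiv : ∀ w ∈ Set.uIcc (1 : ℝ) q, HasDerivAt (antiF d L) (hfun w) w := by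
      intro w hw
      rw [Set.uIcc_of_le hq] at hw
      exact hasDerivAt_antiF d L (by linarith [hw.1])
    rw [intervalIntegral.integral_eq_sub_of_hasDerivAt hderiv hc2.intervalIntegrable]
    simp only [antiF, hd, hL, Real.log_one, Real.sqrt_one]
    have hs0 : Real.sqrt q ≠ 0 := (Real.sqrt_pos.mpr hq0).ne'
    field_simp
    ring
  -- Step 6: the `T`-part of the bulk
  have step7 : ∫ w in (1 : ℝ)..q, Tpart w ≤ d * L * C := by
    have hcT : ContinuousOn (fun w ↦ d * L * thetaMajor w) (Set.uIcc (1 : ℝ) q) :=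
      (continuousOn_const.mul continuousOn_thetaMajor').mono hsubI
    have hle : ∫ w in (1 : ℝ)..q, Tpart w ≤ ∫ w in (1 : ℝ)..q, d * L * thetaMajor w := by
      refine intervalIntegral.integral_mono_on hq hc1.intervalIntegrable hcT.intervalIntegrable fun w hw ↦ ?_
      have hw0 : 0 < w := by linarith [hw.1]
      have hsw : 0 < Real.sqrt w := Real.sqrt_pos.mpr hw0
      have hsw1 : 1 ≤ Real.sqrt w := Real.one_le_sqrt.mpr hw.1
      have hswd : Real.sqrt w ≤ d := by rw [hd]; exact Real.sqrt_le_sqrt hw.2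
      have hlogw : 0 ≤ Real.log w := Real.log_nonneg hw.1
      have hlogwL : Real.log w ≤ L := by rw [hL]; exact Real.log_le_log hw0 hw.2
      simp only [hTpart]
      have hA : 0 ≤ L - Real.log w := by linarith
      have hB0 : 0 ≤ d * w⁻¹ - (Real.sqrt w)⁻¹ := by
        rw [sub_nonneg, inv_le_iff_one_le_mul₀ hsw]
        have hsw2 : Real.sqrt w * Real.sqrt w = w := Real.mul_self_sqrt hw0.le
        rw [show d * w⁻¹ * Real.sqrt w = d * Real.sqrt w / w by ring, le_div_iff₀ hw0]
        nlinarith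
      have hB : d * w⁻¹ - (Real.sqrt w)⁻¹ ≤ d := by
        have : d * w⁻¹ ≤ d * 1 := mul_le_mul_of_nonneg_left (inv_le_one_of_one_le₀ hw.1) hd0.le
        linarith [inv_pos.mpr hsw]
      calc thetaMajor w * ((L - Real.log w) * (d * w⁻¹ - (Real.sqrt w)⁻¹))
          ≤ thetaMajor w * (L * d) := by
            refine mul_le_mul_of_nonneg_left ?_ (thetaMajor_nonneg w)
            exact mul_le_mul (by linarith) hB hB0 hL0
        _ = d * L * thetaMajor w := by ring
    have h2 : ∫ w in (1 : ℝ)..q, d * L * thetaMajor w = d * L * ∫ w in Ioc 1 q, thetaMajor w := by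
      rw [intervalIntegral.integral_const_mul, intervalIntegral.integral_of_le hq]
    have h3 : ∫ w in Ioc 1 q, thetaMajor w ≤ C := by
      rw [hC]
      exact setIntegral_mono_set hIT (ae_of_all _ fun v ↦ thetaMajor_nonneg v)
        (ae_of_all _ Ioc_subset_Ioi_self)
    rw [h2] at hle
    exact hle.trans (mul_le_mul_of_nonneg_left h3 (by positivity))
  -- assemble
  rw [step1, step2, step4, step5, step6]
  nlinarith [step3, step7]


/-- **Louboutin 2006, Lemma 9 (16)**: `Ĩ₀(f) ≤ ¼ √f log² f` — here for every real `q ≥ 2`: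
`M(q) = ∫₁^∞ T(t/q)(log t)(t^{−1/2} − t^{−1}) dt ≤ ¼ √q log² q` (the source proves it for `f ≥ 5` by a
contour shift with the exact constants `κ₀′, κ₀″`; the fold gives it with the cruder remainder
`¼ log² q + log q − √q log q + √q (2 log q + 2)/57 ≤ 0`). [cite: Louboutin2006RelativeClassNumbers, Lemma 9 (16) p. 206] -/
theorem logMajorant_le {q : ℝ} (hq : 2 ≤ q) :
    logMajorant q ≤ Real.sqrt q * Real.log q ^ 2 / 4 := by
  have hq1 : (1 : ℝ) ≤ q := by linarith
  have hq0 : 0 < q := by linarith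
  have h := logMajorant_le_aux hq1
  have hC := integral_thetaMajor_le
  have hC0 : 0 ≤ ∫ v in Ioi (1 : ℝ), thetaMajor v :=
    setIntegral_nonneg measurableSet_Ioi fun v _ ↦ thetaMajor_nonneg v
  set d := Real.sqrt q with hd
  set L := Real.log q with hL
  set C := ∫ v in Ioi (1 : ℝ), thetaMajor v with hCdef
  -- `d ≥ √2 > 1.414`, `L = 2 log d`, `log d ≥ ½ log 2 > 0.3465`, `log d ≤ d − 1`
  have hd2 : 1.414 ≤ d := by
    have : (1.414 : ℝ) ≤ Real.sqrt 2 := by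
      rw [Real.le_sqrt (by norm_num) (by norm_num)]; norm_num
    exact this.trans (Real.sqrt_le_sqrt hq)
  have hd0 : 0 < d := by linarith
  set x := Real.log d with hx
  have hLx : L = 2 * x := by
    rw [hx, hd, Real.log_sqrt hq0.le, hL]; ring
  have hx0 : 0.3465 ≤ x := by
    have h2 : Real.log 2 / 2 ≤ x := by
      rw [hx, hd, ← Real.log_sqrt (by norm_num : (0:ℝ) ≤ 2)]
      exact Real.log_le_log (Real.sqrt_pos.mpr (by norm_num)) (Real.sqrt_le_sqrt hq)
    have := Real.log_two_gt_d9
    linarith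
  have hxd : x ≤ d - 1 := by rw [hx]; exact Real.log_le_sub_one_of_pos hd0
  have hL0 : 0 ≤ L := by rw [hLx]; linarith
  -- the remainder is nonpositive
  have hrem : L ^ 2 / 4 + L - d * L + d * (2 * L + 2) * C ≤ 0 := by
    have h1 : d * (2 * L + 2) * C ≤ d * (2 * L + 2) * (1 / 57) :=
      mul_le_mul_of_nonneg_left hC (by positivity)
    rw [hLx] at h1 ⊢
    nlinarith [mul_nonneg (by linarith : (0:ℝ) ≤ x - 0.3465) (by linarith : (0:ℝ) ≤ 53 * d / 57 - 1),
      mul_nonneg (by linarith : (0:ℝ) ≤ x) (by linarith : (0:ℝ) ≤ d - 1 - x)]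
  linarith

/-! ### The split of `∫₀^∞ y^a Θ(y) dy` at `y = 1` (Louboutin's (4)) -/

/-- **Split at `y = 1` and fold `(0, 1)` by the transformation formula**: if
`Θ(y) = ε y^{−1/2} Θ'(1/y)` on `(0, ∞)`, then for real `a`,
`∫₀^∞ y^a Θ(y) dy = ∫₁^∞ y^a Θ(y) dy + ε ∫₁^∞ x^{−a−3/2} Θ'(x) dx` — Louboutin's (4)
`Λ(s, χ) = ∫₁^∞ {θ(t, χ) t^{(s+A)/2} + W(χ) θ(t, χ̄) t^{(1−s+A)/2}} dt/t`. [cite: Louboutin2006RelativeClassNumbers, Lemma 3 (4) p. 201] -/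
theorem integral_rpow_mul_split {Θ Θ' : ℝ → ℂ} {ε : ℂ} (a : ℝ)
    (htrans : ∀ y, 0 < y → Θ y = ε * ((y ^ (-(1 / 2 : ℝ)) : ℝ) : ℂ) * Θ' (1 / y))
    (hint : IntegrableOn (fun y ↦ ((y ^ a : ℝ) : ℂ) * Θ y) (Ioi 0)) :
    ∫ y in Ioi 0, ((y ^ a : ℝ) : ℂ) * Θ y =
      (∫ y in Ioi 1, ((y ^ a : ℝ) : ℂ) * Θ y) + ε * ∫ x in Ioi 1, ((x ^ (-a - 3 / 2) : ℝ) : ℂ) * Θ' x := by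
  set F : ℝ → ℂ := fun y ↦ ((y ^ a : ℝ) : ℂ) * Θ y with hF
  have hsplit : Ioi (0 : ℝ) = Ioc 0 1 ∪ Ioi 1 := (Ioc_union_Ioi_eq_Ioi zero_le_one).symm
  have hdisj : Disjoint (Ioc (0 : ℝ) 1) (Ioi 1) :=
    Set.disjoint_left.mpr fun x hx hx' ↦ (not_lt.mpr hx.2) hx'
  have e0 : ∫ y in Ioi 0, F y = (∫ y in Ioc 0 1, F y) + ∫ y in Ioi 1, F y := by
    rw [hsplit]
    exact setIntegral_union hdisj measurableSet_Ioi (hint.mono_set Ioc_subset_Ioi_self)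
      (hint.mono_set (Ioi_subset_Ioi zero_le_one))
  have e1 : ∫ y in Ioc 0 1, F y = ε * ∫ x in Ioi 1, ((x ^ (-a - 3 / 2) : ℝ) : ℂ) * Θ' x := by
    have hsub := integral_comp_rpow_Ioi ((Ioc (0 : ℝ) 1).indicator F) (p := -1) (by norm_num)
    rw [setIntegral_indicator measurableSet_Ioc,
      show Ioi (0 : ℝ) ∩ Ioc 0 1 = Ioc 0 1 from Set.inter_eq_right.mpr Ioc_subset_Ioi_self] at hsub
    rw [← hsub]
    have hpt : ∀ x ∈ Ioi (0 : ℝ), (|(-1 : ℝ)| * x ^ ((-1 : ℝ) - 1)) • (Ioc (0 : ℝ) 1).indicator F (x ^ (-1 : ℝ))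
        = (Ici (1 : ℝ)).indicator (fun x ↦ ε * (((x ^ (-a - 3 / 2) : ℝ) : ℂ) * Θ' x)) x := by
      intro x hx
      have hx0 : 0 < x := hx
      rw [Real.rpow_neg_one]
      by_cases h1 : 1 ≤ x
      · have hmem : x⁻¹ ∈ Ioc (0 : ℝ) 1 := ⟨inv_pos.mpr hx0, inv_le_one_of_one_le₀ h1⟩
        rw [indicator_of_mem hmem, indicator_of_mem (show x ∈ Ici (1 : ℝ) from h1), hF]
        simp only
        have e3 : (1 : ℝ) / x⁻¹ = x := by rw [one_div, inv_inv]
        rw [htrans x⁻¹ (inv_pos.mpr hx0), e3, abs_neg, abs_one, one_mul,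
          show ((-1 : ℝ) - 1) = -2 by norm_num, Real.inv_rpow hx0.le, ← Real.rpow_neg hx0.le,
          Real.inv_rpow hx0.le, ← Real.rpow_neg hx0.le, neg_neg]
        have e2 : x ^ (-2 : ℝ) * x ^ (-a) * x ^ (1 / 2 : ℝ) = x ^ (-a - 3 / 2) := by
          rw [← Real.rpow_add hx0, ← Real.rpow_add hx0]; norm_num; ring_nf
        rw [Complex.real_smul]
        have e2c : ((x ^ (-2 : ℝ) : ℝ) : ℂ) * ((x ^ (-a) : ℝ) : ℂ) * ((x ^ (1 / 2 : ℝ) : ℝ) : ℂ) =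
            ((x ^ (-a - 3 / 2) : ℝ) : ℂ) := by
          rw [← Complex.ofReal_mul, ← Complex.ofReal_mul, e2]
        linear_combination (ε * Θ' x : ℂ) * e2c
      · push Not at h1
        have hnmem : x⁻¹ ∉ Ioc (0 : ℝ) 1 := fun h ↦ by
          have := h.2; rw [inv_le_one_iff₀] at this
          rcases this with h' | h' <;> linarith
        rw [indicator_of_notMem hnmem, indicator_of_notMem (show x ∉ Ici (1 : ℝ) from not_le.mpr h1),
          smul_zero]
    rw [setIntegral_congr_fun measurableSet_Ioi hpt, setIntegral_indicator measurableSet_Ici,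
      show Ioi (0 : ℝ) ∩ Ici 1 = Ici 1 from Set.inter_eq_right.mpr fun x (hx : 1 ≤ x) ↦
        (show (0 : ℝ) < x by exact lt_of_lt_of_le one_pos hx),
      integral_Ici_eq_integral_Ioi, integral_const_mul]
  rw [e0, e1, add_comm]


/-! ### The kernel inequality (Louboutin's (11): monotonicity of `s ↦ t^{(s+A)/2−1} − t^{(1−s+A)/2−1}`) -/

/-- The kernel `φ_t(s) = t^{s/2 − 1} + t^{(1−s)/2 − 1}` of `2ξ(s, χ) = ∫₁^∞ φ_t(s) ϑ₀(t, χ) dt`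
(quadratic `χ`, `ε(χ) = 1`). [cite: Louboutin2006RelativeClassNumbers, (4) p. 201] -/
def xiKernel (t s : ℝ) : ℝ := t ^ (s / 2 - 1) + t ^ ((1 - s) / 2 - 1)

/-- **Louboutin's (11) at `A = 0`**: for `t ≥ 1` and `½ ≤ β ≤ 1`,
`0 ≤ φ_t(1) − φ_t(β) ≤ (1 − β) · ½ log t · (t^{−1/2} − t^{−1})` — «for `t ≥ 1` real the function
`s ↦ t^{(s+A)/2−1} − t^{(1−s+A)/2−1}` increases with `s`, and is nonnegative in the range `s ≥ 1/2`».
[cite: Louboutin2006RelativeClassNumbers, (11) p. 203] -/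
theorem xiKernel_one_sub_le {t β : ℝ} (ht : 1 ≤ t) (hβ : 1 / 2 ≤ β) (hβ1 : β ≤ 1) :
    0 ≤ xiKernel t 1 - xiKernel t β ∧
      xiKernel t 1 - xiKernel t β ≤ (1 - β) * (Real.log t * ((Real.sqrt t)⁻¹ - t⁻¹) / 2) := by
  have ht0 : 0 < t := by linarith
  set ℓ := Real.log t with hℓ
  have hℓ0 : 0 ≤ ℓ := Real.log_nonneg ht
  -- `φ` in exponential form
  set φ : ℝ → ℝ := fun s ↦ Real.exp ((s / 2 - 1) * ℓ) + Real.exp (((1 - s) / 2 - 1) * ℓ) with hφ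
  have hφeq : ∀ s, xiKernel t s = φ s := by
    intro s
    simp only [xiKernel, hφ, Real.rpow_def_of_pos ht0, hℓ]
    ring_nf
  have hderiv : ∀ s, HasDerivAt φ (Real.exp ((s / 2 - 1) * ℓ) * (ℓ / 2) -
      Real.exp (((1 - s) / 2 - 1) * ℓ) * (ℓ / 2)) s := by
    intro s
    have h1 : HasDerivAt (fun s : ℝ ↦ (s / 2 - 1) * ℓ) (1 / 2 * ℓ) s := by
      have := ((hasDerivAt_id s).div_const 2).sub_const 1 |>.mul_const ℓ
      simpa using this
    have h2 : HasDerivAt (fun s : ℝ ↦ ((1 - s) / 2 - 1) * ℓ) (-1 / 2 * ℓ) s := by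
      have := (((hasDerivAt_id s).const_sub 1).div_const 2).sub_const 1 |>.mul_const ℓ
      simpa using this
    have := (h1.exp).add (h2.exp)
    refine this.congr_deriv ?_
    ring
  set c : ℝ := Real.log t * ((Real.sqrt t)⁻¹ - t⁻¹) / 2 with hc
  have hsqrt : (Real.sqrt t)⁻¹ = Real.exp (-(1 / 2) * ℓ) := by
    rw [Real.sqrt_eq_rpow, Real.rpow_def_of_pos ht0, ← Real.exp_neg, hℓ]; ring_nf
  have hinv : t⁻¹ = Real.exp (-1 * ℓ) := by
    rw [hℓ, neg_one_mul, Real.exp_neg, Real.exp_log ht0]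
  -- bounds on the derivative on `[1/2, 1]`
  have hderiv_bds : ∀ s ∈ interior (Icc (1 / 2 : ℝ) 1), 0 ≤ deriv φ s ∧ deriv φ s ≤ c := by
    intro s hs
    rw [interior_Icc] at hs
    rw [(hderiv s).deriv]
    have e1 : Real.exp (((1 - s) / 2 - 1) * ℓ) ≤ Real.exp ((s / 2 - 1) * ℓ) :=
      Real.exp_le_exp.mpr (by nlinarith [hs.1])
    have e2 : Real.exp ((s / 2 - 1) * ℓ) ≤ Real.exp (-(1 / 2) * ℓ) :=
      Real.exp_le_exp.mpr (by nlinarith [hs.2])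
    have e3 : Real.exp (-1 * ℓ) ≤ Real.exp (((1 - s) / 2 - 1) * ℓ) :=
      Real.exp_le_exp.mpr (by nlinarith [hs.2])
    constructor
    · nlinarith
    · rw [hc, hsqrt, hinv, ← hℓ]; nlinarith
  have hcont : ContinuousOn φ (Icc (1 / 2 : ℝ) 1) := fun s _ ↦ (hderiv s).continuousAt.continuousWithinAt
  have hdiff : DifferentiableOn ℝ φ (interior (Icc (1 / 2 : ℝ) 1)) :=
    fun s _ ↦ (hderiv s).differentiableAt.differentiableWithinAt
  have hβD : β ∈ Icc (1 / 2 : ℝ) 1 := ⟨hβ, hβ1⟩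
  have h1D : (1 : ℝ) ∈ Icc (1 / 2 : ℝ) 1 := ⟨by norm_num, le_rfl⟩
  have lo := (convex_Icc (1 / 2 : ℝ) 1).mul_sub_le_image_sub_of_le_deriv hcont hdiff
    (fun s hs ↦ (hderiv_bds s hs).1) β hβD 1 h1D hβ1
  have hi := (convex_Icc (1 / 2 : ℝ) 1).image_sub_le_mul_sub_of_deriv_le hcont hdiff
    (fun s hs ↦ (hderiv_bds s hs).2) β hβD 1 h1D hβ1
  rw [hφeq, hφeq]
  constructor
  · linarith
  · calc φ 1 - φ β ≤ c * (1 - β) := hi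
      _ = (1 - β) * c := mul_comm _ _

/-! ### `L(β, χ) = 0 ⇒ L(1, χ) ≤ (1 − β) log² q / 8` for even quadratic primitive `χ` -/

section Quadratic

open DirichletCharacter DirichletTheta

variable {q : ℕ} [NeZero q]

/-- `t ↦ T(t/q) g(t)` is integrable on `(1, ∞)` for `g` continuous on `(0, ∞)` and bounded on `(1, ∞)`. [folklore] -/
private theorem integrableOn_thetaMajor_div_mul' {Q : ℝ} (hQ : 0 < Q) {g : ℝ → ℝ} {B : ℝ}
    (hg : ContinuousOn g (Ioi 0)) (hB : ∀ t, 1 < t → |g t| ≤ B) :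
    IntegrableOn (fun t ↦ thetaMajor (t / Q) * g t) (Ioi 1) := by
  have hQi : 0 < Q⁻¹ := inv_pos.mpr hQ
  have key : IntegrableOn (fun v ↦ thetaMajor v * g (Q * v)) (Ioi (Q⁻¹ * 1)) := by
    rw [mul_one]
    refine integrableOn_thetaMajor_mul' (B := B) hQi ?_ fun v hv ↦ ?_
    · exact hg.comp (continuousOn_const.mul continuousOn_id) fun x (hx : 0 < x) ↦ mul_pos hQ hx
    · apply hB
      have := mul_lt_mul_of_pos_left hv hQ
      rwa [mul_inv_cancel₀ hQ.ne'] at this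
  have h := (integrableOn_Ioi_comp_mul_left_iff (fun v ↦ thetaMajor v * g (Q * v)) 1 hQi).mpr key
  refine h.congr_fun (fun y _ ↦ ?_) measurableSet_Ioi
  show thetaMajor (Q⁻¹ * y) * g (Q * (Q⁻¹ * y)) = thetaMajor (y / Q) * g y
  rw [← mul_assoc, mul_inv_cancel₀ hQ.ne', one_mul, div_eq_inv_mul]

/-- The integrand of `M(q)` is integrable on `(1, ∞)`. [folklore] -/
private theorem integrableOn_logMajorant_integrand {Q : ℝ} (hQ : 0 < Q) :
    IntegrableOn (fun t ↦ thetaMajor (t / Q) * (Real.log t * ((Real.sqrt t)⁻¹ - t⁻¹))) (Ioi 1) := by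
  refine integrableOn_thetaMajor_div_mul' hQ (B := 2 + 2) ?_ fun t ht ↦ ?_
  · refine (Real.continuousOn_log.mono fun x (hx : 0 < x) ↦ hx.ne').mul ?_
    exact ((Real.continuous_sqrt.continuousOn).inv₀ fun x (hx : 0 < x) ↦ (Real.sqrt_pos.mpr hx).ne').sub
      (continuousOn_inv₀.mono fun x (hx : 0 < x) ↦ hx.ne')
  · have ht0 : 0 < t := by linarith
    have hst : 0 < Real.sqrt t := Real.sqrt_pos.mpr ht0
    have hst1 : 1 ≤ Real.sqrt t := Real.one_le_sqrt.mpr ht.le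
    have hlog : 0 ≤ Real.log t := Real.log_nonneg ht.le
    have hlog2 := log_le_two_sqrt ht0.le
    rw [abs_mul, abs_of_nonneg hlog]
    have hB : |(Real.sqrt t)⁻¹ - t⁻¹| ≤ (Real.sqrt t)⁻¹ + t⁻¹ := by
      refine (abs_sub _ _).trans (le_of_eq ?_)
      rw [abs_of_nonneg (by positivity), abs_of_nonneg (by positivity)]
    have e1 : Real.log t * (Real.sqrt t)⁻¹ ≤ 2 := by rw [mul_inv_le_iff₀ hst]; linarith
    have e2 : Real.log t * t⁻¹ ≤ 2 := by
      rw [mul_inv_le_iff₀ ht0]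
      have : Real.sqrt t ≤ t := by
        calc Real.sqrt t = Real.sqrt t * 1 := (mul_one _).symm
          _ ≤ Real.sqrt t * Real.sqrt t := mul_le_mul_of_nonneg_left hst1 hst.le
          _ = t := Real.mul_self_sqrt ht0.le
      linarith
    calc Real.log t * |(Real.sqrt t)⁻¹ - t⁻¹| ≤ Real.log t * ((Real.sqrt t)⁻¹ + t⁻¹) :=
          mul_le_mul_of_nonneg_left hB hlog
      _ = Real.log t * (Real.sqrt t)⁻¹ + Real.log t * t⁻¹ := by ring
      _ ≤ 2 + 2 := add_le_add e1 e2

variable {χ : DirichletCharacter ℂ q}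

/-- `∫₀^∞ y^{σ/2−1} ϑ₀(y, χ) dy` converges for every real `σ` and its integrand is the real-power
form of the Mellin integrand. [folklore] -/
private theorem integrableOn_rpow_mul_dirichletTheta (hχ : χ ≠ 1) (a : ℝ) :
    IntegrableOn (fun y : ℝ ↦ ((y ^ a : ℝ) : ℂ) * dirichletTheta 0 χ y) (Ioi 0) := by
  have h := mellinConvergent_dirichletTheta_zero hχ ((a : ℂ) + 1)
  rw [MellinConvergent] at h
  refine h.congr_fun (fun y (hy : 0 < y) ↦ ?_) measurableSet_Ioi
  show (y : ℂ) ^ ((a : ℂ) + 1 - 1) • dirichletTheta 0 χ y = _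
  rw [smul_eq_mul, add_sub_cancel_right, Complex.ofReal_cpow hy.le]

/-- **Louboutin's (4) for an even quadratic primitive character** (`W(χ) = 1`, `χ̄ = χ`): for real `σ`,
`2 ξ(σ, χ) = ∫₁^∞ (t^{σ/2−1} + t^{(1−σ)/2−1}) ϑ₀(t, χ) dt`. [cite: Louboutin2006RelativeClassNumbers, Lemma 3 (4) p. 201] -/
theorem two_mul_dirichletXi_eq_integral_xiKernel (hprim : χ.IsPrimitive) (hχ : χ ≠ 1)
    (heven : χ.Even) (hquad : χ.IsQuadratic) (σ : ℝ) :
    2 * dirichletXi χ σ = ∫ t in Ioi (1 : ℝ), ((xiKernel t σ : ℝ) : ℂ) * dirichletTheta 0 χ t := by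
  have hκ : charParity χ = 0 := charParity_of_even heven
  have hε : rootNumber χ = 1 := PrimitiveQuadratic.rootNumber_eq_one_of_isQuadratic hprim hquad
  have hinv : χ⁻¹ = χ := hquad.inv
  -- `ξ(σ) = ½ ∫₀^∞ t^{σ/2 - 1} ϑ(t) dt`
  have hxi := dirichletXi_eq_mellin hχ σ
  rw [hκ, Nat.cast_zero, add_zero] at hxi
  have hmel : mellin (dirichletTheta 0 χ) ((σ : ℂ) / 2) =
      ∫ y in Ioi 0, (((y ^ (σ / 2 - 1) : ℝ)) : ℂ) * dirichletTheta 0 χ y := by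
    rw [mellin]
    refine setIntegral_congr_fun measurableSet_Ioi fun y (hy : 0 < y) ↦ ?_
    rw [smul_eq_mul, show (σ : ℂ) / 2 - 1 = ((σ / 2 - 1 : ℝ) : ℂ) by push_cast; ring,
      Complex.ofReal_cpow hy.le]
  -- split and fold
  have htrans : ∀ y : ℝ, 0 < y → dirichletTheta 0 χ y =
      rootNumber χ * ((y ^ (-(1 / 2 : ℝ)) : ℝ) : ℂ) * dirichletTheta 0 χ (1 / y) := by
    intro y hy
    have h := dirichletTheta_transformation hprim hy
    rw [hκ, Nat.cast_zero, add_zero, hinv] at h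
    exact h
  have hsplit := integral_rpow_mul_split (σ / 2 - 1) htrans (integrableOn_rpow_mul_dirichletTheta hχ _)
  rw [hε, one_mul, show (-(σ / 2 - 1) - 3 / 2 : ℝ) = (1 - σ) / 2 - 1 by ring] at hsplit
  have hI1 : IntegrableOn (fun y : ℝ ↦ ((y ^ (σ / 2 - 1) : ℝ) : ℂ) * dirichletTheta 0 χ y) (Ioi 1) :=
    (integrableOn_rpow_mul_dirichletTheta hχ _).mono_set (Ioi_subset_Ioi zero_le_one)
  have hI2 : IntegrableOn (fun y : ℝ ↦ ((y ^ ((1 - σ) / 2 - 1) : ℝ) : ℂ) * dirichletTheta 0 χ y) (Ioi 1) :=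
    (integrableOn_rpow_mul_dirichletTheta hχ _).mono_set (Ioi_subset_Ioi zero_le_one)
  rw [hxi, hmel, hsplit, ← integral_add hI1 hI2]
  rw [show (2 : ℂ) * (1 / 2 * _) = _ from by ring]
  refine setIntegral_congr_fun measurableSet_Ioi fun t _ ↦ ?_
  simp only [xiKernel]; push_cast; ring

/-- `‖ξ(1, χ)‖ = √q · |L(1, χ)|` for even `χ ≠ 1` (`Γ(1/2)(q/π)^{1/2} = √q`). [cite: Louboutin2006RelativeClassNumbers, Lemma 6 p. 203] -/
theorem norm_dirichletXi_one (hχ : χ ≠ 1) (heven : χ.Even) :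
    ‖dirichletXi χ 1‖ = Real.sqrt q * ‖χ.LFunction 1‖ := by
  have hq0 : (0 : ℝ) < q := by exact_mod_cast NeZero.pos q
  have hκ : charParity χ = 0 := charParity_of_even heven
  have hxiL := dirichletXi_eq_LFunction_mul hχ (s := 1) (fun n ↦ by
    rw [hκ, Nat.cast_zero, add_zero]
    intro h
    have := congrArg Complex.re h
    simp at this
    linarith)
  rw [hκ, Nat.cast_zero, add_zero] at hxiL
  have e1 : ‖Complex.Gamma (1 / 2)‖ = π ^ (1 / 2 : ℝ) := by
    rw [Complex.Gamma_one_half_eq, Complex.norm_cpow_eq_rpow_re_of_pos Real.pi_pos]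
    norm_num
  have e2 : ‖((q : ℂ) / π) ^ (1 / 2 : ℂ)‖ = ((q : ℝ) / π) ^ (1 / 2 : ℝ) := by
    rw [show ((q : ℂ) / π) = (((q : ℝ) / π : ℝ) : ℂ) by push_cast; rfl,
      Complex.norm_cpow_eq_rpow_re_of_pos (div_pos hq0 Real.pi_pos)]
    norm_num
  rw [hxiL, norm_mul, norm_mul, e1, e2, mul_assoc,
    ← Real.mul_rpow Real.pi_pos.le (div_pos hq0 Real.pi_pos).le,
    mul_div_cancel₀ _ Real.pi_pos.ne', mul_comm, Real.sqrt_eq_rpow]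

/-- **Louboutin 2006, Theorem 1 (ii) — even case, `½ ≤ β < 1`** (= Louboutin 2001, Thm 7 (16) for
quadratic `χ`): for an even quadratic primitive `χ ≠ 1` mod `q`, if `L(β, χ) = 0` with `½ ≤ β ≤ 1` then
`|L(1, χ)| ≤ (1 − β) log² q / 8`. [cite: Louboutin2006RelativeClassNumbers, Thm 1 (3) p. 200] -/
theorem norm_LFunction_one_le_of_zero_of_half_le (hprim : χ.IsPrimitive) (hχ : χ ≠ 1)
    (heven : χ.Even) (hquad : χ.IsQuadratic) {β : ℝ} (hβ : 1 / 2 ≤ β) (hβ1 : β ≤ 1)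
    (hzero : χ.LFunction β = 0) :
    ‖χ.LFunction 1‖ ≤ (1 - β) * Real.log q ^ 2 / 8 := by
  have hq1 : q ≠ 1 := by rintro rfl; exact hχ χ.level_one
  have hq2 : (2 : ℝ) ≤ q := by
    have h0 := NeZero.ne q
    have : 2 ≤ q := by omega
    exact_mod_cast this
  have hq0 : (0 : ℝ) < q := by linarith
  have hκ : charParity χ = 0 := charParity_of_even heven
  -- `ξ(β) = 0`
  have hxiβ : dirichletXi χ β = 0 := by
    refine (dirichletXi_eq_zero_iff hχ fun n h ↦ ?_).mpr hzero
    rw [hκ, Nat.cast_zero, add_zero] at h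
    have := congrArg Complex.re h
    simp at this
    have : (0 : ℝ) ≤ n := n.cast_nonneg
    linarith
  -- `2ξ(1) = ∫ (φ_t(1) − φ_t(β)) ϑ(t) dt`
  have h1 := two_mul_dirichletXi_eq_integral_xiKernel hprim hχ heven hquad 1
  have hβ' := two_mul_dirichletXi_eq_integral_xiKernel hprim hχ heven hquad β
  rw [hxiβ, mul_zero] at hβ'
  have hIk : ∀ σ : ℝ, IntegrableOn (fun t : ℝ ↦ ((xiKernel t σ : ℝ) : ℂ) * dirichletTheta 0 χ t) (Ioi 1) := by
    intro σ
    have hI1 : IntegrableOn (fun y : ℝ ↦ ((y ^ (σ / 2 - 1) : ℝ) : ℂ) * dirichletTheta 0 χ y) (Ioi 1) :=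
      (integrableOn_rpow_mul_dirichletTheta hχ _).mono_set (Ioi_subset_Ioi zero_le_one)
    have hI2 : IntegrableOn (fun y : ℝ ↦ ((y ^ ((1 - σ) / 2 - 1) : ℝ) : ℂ) * dirichletTheta 0 χ y) (Ioi 1) :=
      (integrableOn_rpow_mul_dirichletTheta hχ _).mono_set (Ioi_subset_Ioi zero_le_one)
    refine (hI1.add hI2).congr_fun (fun t _ ↦ ?_) measurableSet_Ioi
    simp only [xiKernel, Pi.add_apply]; push_cast; ring
  rw [Complex.ofReal_one] at h1
  have hdiff : 2 * dirichletXi χ 1 =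
      ∫ t in Ioi (1 : ℝ), (((xiKernel t 1 - xiKernel t β : ℝ)) : ℂ) * dirichletTheta 0 χ t := by
    have : ∫ t in Ioi (1 : ℝ), (((xiKernel t 1 - xiKernel t β : ℝ)) : ℂ) * dirichletTheta 0 χ t =
        (∫ t in Ioi (1 : ℝ), ((xiKernel t 1 : ℝ) : ℂ) * dirichletTheta 0 χ t) -
        ∫ t in Ioi (1 : ℝ), ((xiKernel t β : ℝ) : ℂ) * dirichletTheta 0 χ t := by
      rw [← integral_sub (hIk 1) (hIk β)]
      refine setIntegral_congr_fun measurableSet_Ioi fun t _ ↦ ?_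
      push_cast; ring
    rw [this, ← h1, ← hβ', sub_zero]
  -- the majorant
  have hmaj : ‖2 * dirichletXi χ 1‖ ≤ (1 - β) * logMajorant q := by
    rw [hdiff, logMajorant, ← integral_const_mul]
    refine norm_integral_le_of_norm_le ((integrableOn_logMajorant_integrand hq0).const_mul _) ?_
    refine (ae_restrict_iff' measurableSet_Ioi).mpr (ae_of_all _ fun t (ht : 1 < t) ↦ ?_)
    have ht0 : 0 < t := by linarith
    obtain ⟨hlo, hhi⟩ := xiKernel_one_sub_le ht.le hβ hβ1
    rw [norm_mul, Complex.norm_real, Real.norm_eq_abs, abs_of_nonneg hlo]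
    have hθ := norm_dirichletTheta_zero_le χ heven hq1 ht0
    have hT0 : 0 ≤ thetaMajor (t / q) := thetaMajor_nonneg _
    calc (xiKernel t 1 - xiKernel t β) * ‖dirichletTheta 0 χ t‖
        ≤ ((1 - β) * (Real.log t * ((Real.sqrt t)⁻¹ - t⁻¹) / 2)) * (2 * thetaMajor (t / q)) :=
          mul_le_mul hhi hθ (norm_nonneg _) (by nlinarith)
      _ = (1 - β) * (thetaMajor (t / q) * (Real.log t * ((Real.sqrt t)⁻¹ - t⁻¹))) := by ring
  have hM := logMajorant_le hq2
  rw [norm_mul, Complex.norm_ofNat, norm_dirichletXi_one hχ heven] at hmaj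
  have hsq : 0 < Real.sqrt q := Real.sqrt_pos.mpr hq0
  have h1β : 0 ≤ 1 - β := by linarith
  have : 2 * (Real.sqrt q * ‖χ.LFunction 1‖) ≤ (1 - β) * (Real.sqrt q * Real.log q ^ 2 / 4) :=
    hmaj.trans (mul_le_mul_of_nonneg_left hM h1β)
  have : Real.sqrt q * (2 * ‖χ.LFunction 1‖) ≤ Real.sqrt q * ((1 - β) * Real.log q ^ 2 / 4) := by
    nlinarith
  have := le_of_mul_le_mul_left this hsq
  linarith

/-- **Louboutin 2006, Theorem 1 (ii), even case** (= Louboutin 2001 Thm 7 (16) for quadratic `χ`):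
«Let `χ` be a primitive Dirichlet character modulo `f > 1`. … (ii) Assume that `χ` is quadratic. Then
`0 < β < 1` and `L(β, χ) = 0` imply **(3)** `0 < L(1, χ) ≤ (1 − β) log² f / 8`» — proved here for EVEN
`χ` (the odd case needs the contour-shift bound (17) for `Ĩ₁(f)`, NOT here); the reduction to
`β ≥ ½` is the functional equation `ξ(s, χ) = ξ(1 − s, χ)` (`ε(χ) = 1`).
[cite: Louboutin2006RelativeClassNumbers, Thm 1 (3) p. 200] -/
theorem norm_LFunction_one_le_of_zero (hprim : χ.IsPrimitive) (hχ : χ ≠ 1)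
    (heven : χ.Even) (hquad : χ.IsQuadratic) {β : ℝ} (hβ0 : 0 < β) (hβ1 : β < 1)
    (hzero : χ.LFunction β = 0) :
    ‖χ.LFunction 1‖ ≤ (1 - β) * Real.log q ^ 2 / 8 := by
  rcases le_or_gt (1 / 2 : ℝ) β with hβ | hβ
  · exact norm_LFunction_one_le_of_zero_of_half_le hprim hχ heven hquad hβ hβ1.le hzero
  · -- reflect: `L(1 − β, χ) = 0`
    have hκ : charParity χ = 0 := charParity_of_even heven
    have hε : rootNumber χ = 1 := PrimitiveQuadratic.rootNumber_eq_one_of_isQuadratic hprim hquad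
    have hxiβ : dirichletXi χ β = 0 := by
      refine (dirichletXi_eq_zero_iff hχ fun n h ↦ ?_).mpr hzero
      rw [hκ, Nat.cast_zero, add_zero] at h
      have := congrArg Complex.re h
      simp at this
      have : (0 : ℝ) ≤ n := n.cast_nonneg
      linarith
    have hfe := dirichletXi_eq_rootNumber_mul_dirichletXi_inv_one_sub hprim (β : ℂ)
    rw [hxiβ, hε, one_mul, hquad.inv] at hfe
    have hzero' : χ.LFunction ((1 - β : ℝ) : ℂ) = 0 := by
      push_cast
      refine (dirichletXi_eq_zero_iff hχ fun n h ↦ ?_).mp hfe.symm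
      rw [hκ, Nat.cast_zero, add_zero] at h
      have := congrArg Complex.re h
      simp at this
      have : (0 : ℝ) ≤ n := n.cast_nonneg
      linarith
    have h := norm_LFunction_one_le_of_zero_of_half_le hprim hχ heven hquad (β := 1 - β)
      (by linarith) (by linarith) hzero'
    have hlog : 0 ≤ Real.log q ^ 2 := sq_nonneg _
    nlinarith

/-- The printed form **`0 < L(1, χ) ≤ (1 − β) log² f / 8`** on the real number `L(1, χ)` (quadratic `χ`:
`L(1, χ)` is real and positive — tree `Siegel.LFunction_one_re_pos`). [cite: Louboutin2006RelativeClassNumbers, Thm 1 (3) p. 200] -/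
theorem LFunction_one_re_pos_and_le_of_zero (hprim : χ.IsPrimitive) (hχ : χ ≠ 1)
    (heven : χ.Even) (hquad : χ.IsQuadratic) {β : ℝ} (hβ0 : 0 < β) (hβ1 : β < 1)
    (hzero : χ.LFunction β = 0) :
    0 < (χ.LFunction 1).re ∧ (χ.LFunction 1).re ≤ (1 - β) * Real.log q ^ 2 / 8 := by
  have hsq : χ ^ 2 = 1 := hquad.sq_eq_one
  refine ⟨Siegel.LFunction_one_re_pos χ hχ hsq, ?_⟩
  exact (Complex.re_le_norm _).trans (norm_LFunction_one_le_of_zero hprim hχ heven hquad hβ0 hβ1 hzero)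

end Quadratic

end Louboutin2001

end Literature.NumberTheory.LFunctions
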